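import Summits.QuantumFields.YangMills.Theorems.LevelShiftBootstrapHistoryTailOfLocalStabilityChain
import Summits.QuantumFields.YangMills.Theorems.CutoffNotchTransportHistoryTailOfNotchRated

/-!
# The level-shift bootstrap, part 3: the cross-ratio chain at the level of measures, and the summation of the conditioning defects —
# helper toward `LevelShiftBootstrap.HistoryTailOfLocalStability` (stmt-QuantumFields-26949), route-independent (no `Theses` import)

Width seat `ym-line-sfw-p2-w3` g22 (home cell `ym-idea-1`), `--supports stmt-QuantumFields-26949`.

§1 `real_le_of_crossRatio_chain`: ABSTRACT form of the chain of route `LevelShiftBootstrap` — a sequence of probability spaces `(X_J, μ_J)`,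
events `E_J ⊆ X_J` (the unit-plaquette threshold events at the drifting thresholds `τ_J θ`), conditioning events `G_J ⊆ X_J` (run `J`) and
`G'_J ⊆ X_{J+1}` (run `J + 1` at the comparison height of run `J`), and the crux's CROSS-MULTIPLIED one-step cross-ratio bounds
`μ_{J+1}(E_{J+1} ∩ G'_J)·μ_J(G_J) ≤ e^{ρ_J}·μ_J(E_J ∩ G_J)·μ_{J+1}(G'_J)` for `m ≤ J < K` give, as soon as every `μ_J(G_Jᶜ) ≤ ½`,
`μ_K(E_K) ≤ exp(Σ_{m≤J<K}(ρ_J + 2μ_J(G_Jᶜ)))·(μ_m(E_m) + Σ_{m≤J<K} μ_{J+1}(G'_Jᶜ)) + μ_K(G_Kᶜ)` (the scalar `chain_bound` of part 1 fed with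
`a_J = μ_J(E_J ∩ G_J)`; no division by a possibly vanishing mass is ever performed).
§2 Summation bookkeeping on the base family `F`: the plaquettes of level `j` of run `K` number `≤ 72·L^{3m}·(L^{K−j})³` (`card_plaq_le_height`),
so a per-plaquette bound `B(K − j)` sums to `W(K − j)`, `W(i) = 72L^{3m}(L^i)³·B(i)` (`sum_plaq_le_W`); and over the constrained levels
`j ≤ J − n` of run `J + h` a `¼`-dominated `W` sums to `≤ (4/3)·W(h + n)` (`sum_range_W_le`, the reflected geometric series).

HONEST FRAMING.  Measure-theoretic bookkeeping; no estimate of Bałaban's is asserted; the crux `LocalUnitStabilityL` (27016) is untouched; rung R3 is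
a RECORD rung — no summit, no Clay claim; the Yang–Mills mass gap is NOT proved by any of this.  No `def`, no `sorry`.

References: C. King, CMP **102** (1986) 649–677 [King1986] (Thm 3.4 (3.9)–(3.13) p.656); T. Bałaban, CMP **102** (1985) 255–275 [Balaban1985UV3]
((7) p.257).
-/

set_option autoImplicit false

noncomputable section

open MeasureTheory
open scoped BigOperators
open Literature.MathematicalPhysics.QuantumFieldTheory
open Literature.MathematicalPhysics.QuantumFieldTheory.Balaban1983to89
open Literature.MathematicalPhysics.QuantumFieldTheory.Balaban1983to89.T3ContinuumYM3Torus

namespace Summit.QuantumFields.YangMills.Theorems.HistoryTailOfLocalStability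

/-! ## §1 The cross-ratio chain at the level of measures -/

section MeasureChain

variable {X : ℕ → Type*} [∀ J, MeasurableSpace (X J)] (μ : ∀ J, Measure (X J)) [∀ J, IsProbabilityMeasure (μ J)]
  (E G : ∀ J, Set (X J)) (G' : ∀ J, Set (X (J + 1)))

/-- **ONE STEP OF THE CHAIN**: from the cross-multiplied cross-ratio bound and `μ_J(G_Jᶜ) ≤ ½`,
`μ_{J+1}(E_{J+1} ∩ G_{J+1}) ≤ e^{ρ_J}·μ_J(E_J ∩ G_J)/(1 − μ_J(G_Jᶜ)) + μ_{J+1}(G'_Jᶜ)`. [cite: King1986, Thm 3.4 (3.9) p.656] -/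
theorem real_inter_succ_le_of_crossRatio (hG : ∀ J, MeasurableSet (G J)) {ρ : ℕ → ℝ} {J : ℕ}
    (hstep : (μ (J + 1)).real (E (J + 1) ∩ G' J) * (μ J).real (G J) ≤
      Real.exp (ρ J) * (μ J).real (E J ∩ G J) * (μ (J + 1)).real (G' J))
    (hhalf : (μ J).real (G J)ᶜ ≤ 1 / 2) :
    (μ (J + 1)).real (E (J + 1) ∩ G (J + 1)) ≤
      Real.exp (ρ J) * (μ J).real (E J ∩ G J) / (1 - (μ J).real (G J)ᶜ) + (μ (J + 1)).real (G' J)ᶜ := by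
  have hGJ : (μ J).real (G J) = 1 - (μ J).real (G J)ᶜ := by
    rw [probReal_compl_eq_one_sub (hG J)]; ring
  have hpos : 0 < 1 - (μ J).real (G J)ᶜ := by linarith
  -- `E ∩ G ⊆ (E ∩ G') ∪ G'ᶜ`
  have hsub : E (J + 1) ∩ G (J + 1) ⊆ (E (J + 1) ∩ G' J) ∪ (G' J)ᶜ := by
    intro x hx
    by_cases hx' : x ∈ G' J
    · exact Or.inl ⟨hx.1, hx'⟩
    · exact Or.inr hx'
  have h1 : (μ (J + 1)).real (E (J + 1) ∩ G (J + 1)) ≤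
      (μ (J + 1)).real (E (J + 1) ∩ G' J) + (μ (J + 1)).real (G' J)ᶜ :=
    (measureReal_mono hsub (measure_ne_top _ _)).trans (measureReal_union_le _ _)
  -- the cross-ratio bound divided by `μ_J(G_J) = 1 − μ_J(G_Jᶜ) > 0`, with `μ_{J+1}(G'_J) ≤ 1`
  have h2 : (μ (J + 1)).real (E (J + 1) ∩ G' J) ≤
      Real.exp (ρ J) * (μ J).real (E J ∩ G J) / (1 - (μ J).real (G J)ᶜ) := by
    rw [le_div_iff₀ hpos, ← hGJ]
    refine hstep.trans ?_
    have h3 : (μ (J + 1)).real (G' J) ≤ 1 := measureReal_le_one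
    have h4 : 0 ≤ Real.exp (ρ J) * (μ J).real (E J ∩ G J) := mul_nonneg (Real.exp_pos _).le measureReal_nonneg
    calc Real.exp (ρ J) * (μ J).real (E J ∩ G J) * (μ (J + 1)).real (G' J)
        ≤ Real.exp (ρ J) * (μ J).real (E J ∩ G J) * 1 := mul_le_mul_of_nonneg_left h3 h4
      _ = Real.exp (ρ J) * (μ J).real (E J ∩ G J) := mul_one _
  linarith

/-- The scalar chain of part 1 with the run-`J+1` defect indexed by `J`: `a_{J+1} ≤ e^{ρ_J}a_J/(1 − c_J) + d_J` (`J ≥ m`) gives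
`a_K ≤ exp(Σ_{m≤J<K}(ρ_J + 2c_J))·(a_m + Σ_{m≤J<K} d_J)`. [cite: King1986, Thm 3.4 (3.9)-(3.13) p.656] -/
theorem chain_bound' {a c d ρ : ℕ → ℝ} {m : ℕ} (ha : ∀ J, 0 ≤ a J) (hd : ∀ J, 0 ≤ d J)
    (hρ : ∀ J, m ≤ J → 0 ≤ ρ J) (hc0 : ∀ J, m ≤ J → 0 ≤ c J) (hc : ∀ J, m ≤ J → c J ≤ 1 / 2)
    (hstep : ∀ J, m ≤ J → a (J + 1) ≤ Real.exp (ρ J) * a J / (1 - c J) + d J) (K : ℕ) (hK : m ≤ K) :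
    a K ≤ Real.exp (∑ J ∈ Finset.Ico m K, (ρ J + 2 * c J)) * (a m + ∑ J ∈ Finset.Ico m K, d J) := by
  have key := chain_bound (c' := fun J => d (J - 1)) ha (fun J => hd _) hρ hc0 hc
    (fun J hJ => by simpa only [Nat.add_sub_cancel] using hstep J hJ) K hK
  have hsum : ∑ J ∈ Finset.Ico (m + 1) (K + 1), d (J - 1) = ∑ J ∈ Finset.Ico m K, d J := by
    rw [← Finset.sum_Ico_add' (fun J => d (J - 1)) m K 1]
    exact Finset.sum_congr rfl fun J _ => by rw [Nat.add_sub_cancel]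
  rw [hsum] at key
  exact key

/-- **THE CHAIN AT THE LEVEL OF MEASURES** (module docstring §1). [cite: King1986, Thm 3.4 (3.9)-(3.13) p.656] -/
theorem real_inter_le_of_crossRatio_chain (hG : ∀ J, MeasurableSet (G J)) {ρ : ℕ → ℝ} (hρ : ∀ J, 0 ≤ ρ J) {m K : ℕ} (hmK : m ≤ K)
    (hstep : ∀ J, m ≤ J → J < K → (μ (J + 1)).real (E (J + 1) ∩ G' J) * (μ J).real (G J) ≤
      Real.exp (ρ J) * (μ J).real (E J ∩ G J) * (μ (J + 1)).real (G' J))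
    (hhalf : ∀ J, m ≤ J → J < K → (μ J).real (G J)ᶜ ≤ 1 / 2) :
    (μ K).real (E K ∩ G K) ≤ Real.exp (∑ J ∈ Finset.Ico m K, (ρ J + 2 * (μ J).real (G J)ᶜ)) *
      ((μ m).real (E m ∩ G m) + ∑ J ∈ Finset.Ico m K, (μ (J + 1)).real (G' J)ᶜ) := by
  classical
  -- truncated sequences, so that the scalar chain's hypotheses hold for every `J ≥ m`
  let a : ℕ → ℝ := fun J => if J ≤ K then (μ J).real (E J ∩ G J) else 0
  let c : ℕ → ℝ := fun J => if J < K then (μ J).real (G J)ᶜ else 0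
  have ha : ∀ J, 0 ≤ a J := fun J => by
    simp only [a]; split_ifs
    · exact measureReal_nonneg
    · exact le_rfl
  have hc0 : ∀ J, m ≤ J → 0 ≤ c J := fun J _ => by
    simp only [c]; split_ifs
    · exact measureReal_nonneg
    · exact le_rfl
  have hc : ∀ J, m ≤ J → c J ≤ 1 / 2 := fun J hJ => by
    simp only [c]; split_ifs with h
    · exact hhalf J hJ h
    · norm_num
  have hstep' : ∀ J, m ≤ J → a (J + 1) ≤ Real.exp (ρ J) * a J / (1 - c J) + (μ (J + 1)).real (G' J)ᶜ := by
    intro J hJ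
    by_cases hJK : J < K
    · have hJ1 : J + 1 ≤ K := hJK
      have e1 : a (J + 1) = (μ (J + 1)).real (E (J + 1) ∩ G (J + 1)) := by simp only [a, if_pos hJ1]
      have e2 : a J = (μ J).real (E J ∩ G J) := by simp only [a, if_pos hJK.le]
      have e3 : c J = (μ J).real (G J)ᶜ := by simp only [c, if_pos hJK]
      rw [e1, e2, e3]
      exact real_inter_succ_le_of_crossRatio μ E G G' hG (hstep J hJ hJK) (hhalf J hJ hJK)
    · have hJ1 : ¬ J + 1 ≤ K := by omega
      have e1 : a (J + 1) = 0 := by simp only [a, if_neg hJ1]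
      rw [e1]
      have h1 : 0 ≤ Real.exp (ρ J) * a J / (1 - c J) := by
        refine div_nonneg (mul_nonneg (Real.exp_pos _).le (ha J)) ?_
        have := hc J hJ; linarith
      have h2 : 0 ≤ (μ (J + 1)).real (G' J)ᶜ := measureReal_nonneg
      linarith
  have key := chain_bound' ha (fun J => measureReal_nonneg) (fun J _ => hρ J) hc0 hc hstep' K hmK
  have haK : a K = (μ K).real (E K ∩ G K) := by simp only [a, if_pos le_rfl]
  have ham : a m = (μ m).real (E m ∩ G m) := by simp only [a, if_pos hmK]
  have hsum1 : ∑ J ∈ Finset.Ico m K, (ρ J + 2 * c J) = ∑ J ∈ Finset.Ico m K, (ρ J + 2 * (μ J).real (G J)ᶜ) :=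
    Finset.sum_congr rfl fun J hJ => by simp only [c, if_pos (Finset.mem_Ico.mp hJ).2]
  rw [haK, ham, hsum1] at key
  exact key

/-- **THE CHAIN, READ ON THE BARE EVENTS**: with `E_K ⊆ E'` replaced by the final containment `Ē ⊆ E_K` and the initial one `E_m ⊆ E₀`,
`μ_K(Ē) ≤ exp(Σ_{m≤J<K}(ρ_J + 2μ_J(G_Jᶜ)))·(μ_m(E₀) + Σ_{m≤J<K} μ_{J+1}(G'_Jᶜ)) + μ_K(G_Kᶜ)`. [cite: King1986, Thm 3.4 (3.9)-(3.13) p.656] -/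
theorem real_le_of_crossRatio_chain (hG : ∀ J, MeasurableSet (G J)) {ρ : ℕ → ℝ} (hρ : ∀ J, 0 ≤ ρ J) {m K : ℕ} (hmK : m ≤ K)
    (hstep : ∀ J, m ≤ J → J < K → (μ (J + 1)).real (E (J + 1) ∩ G' J) * (μ J).real (G J) ≤
      Real.exp (ρ J) * (μ J).real (E J ∩ G J) * (μ (J + 1)).real (G' J))
    (hhalf : ∀ J, m ≤ J → J < K → (μ J).real (G J)ᶜ ≤ 1 / 2)
    {Ebar : Set (X K)} (hbar : Ebar ⊆ E K) {E₀ : Set (X m)} (h₀ : E m ⊆ E₀) :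
    (μ K).real Ebar ≤ Real.exp (∑ J ∈ Finset.Ico m K, (ρ J + 2 * (μ J).real (G J)ᶜ)) *
      ((μ m).real E₀ + ∑ J ∈ Finset.Ico m K, (μ (J + 1)).real (G' J)ᶜ) + (μ K).real (G K)ᶜ := by
  have key := real_inter_le_of_crossRatio_chain μ E G G' hG hρ hmK hstep hhalf
  -- `Ē ⊆ (E_K ∩ G_K) ∪ G_Kᶜ`
  have hsub : Ebar ⊆ (E K ∩ G K) ∪ (G K)ᶜ := by
    intro x hx
    by_cases hx' : x ∈ G K
    · exact Or.inl ⟨hbar hx, hx'⟩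
    · exact Or.inr hx'
  have h1 : (μ K).real Ebar ≤ (μ K).real (E K ∩ G K) + (μ K).real (G K)ᶜ :=
    (measureReal_mono hsub (measure_ne_top _ _)).trans (measureReal_union_le _ _)
  have h2 : (μ m).real (E m ∩ G m) ≤ (μ m).real E₀ :=
    measureReal_mono (fun x hx => h₀ hx.1) (measure_ne_top _ _)
  have hE0 : 0 ≤ Real.exp (∑ J ∈ Finset.Ico m K, (ρ J + 2 * (μ J).real (G J)ᶜ)) := (Real.exp_pos _).le
  nlinarith [mul_le_mul_of_nonneg_left h2 hE0]

end MeasureChain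

/-! ## §2 Summation bookkeeping on the base family -/

section Bookkeeping

variable (F : T3Family)

/-- **A PER-PLAQUETTE BOUND SUMS TO `W`**: if every plaquette of level `j` of run `K` carries a bound `B(K − j)`, the level sum is at most
`W(K − j) = 72·L^{3m}·(L^{K−j})³·B(K − j)` (`card_plaq_le_height`). [cite: Balaban1985UV3, (7) p.257] -/
theorem sum_plaq_le_W {K j : ℕ} (hj : j ≤ K) {f : Plaq (F.P K) j → ℝ} {B : ℕ → ℝ} (hB : 0 ≤ B (K - j))
    (hf : ∀ q, f q ≤ B (K - j)) :
    ∑ q : Plaq (F.P K) j, f q ≤ 72 * (F.L : ℝ) ^ (3 * F.m) * ((F.L : ℝ) ^ (K - j)) ^ 3 * B (K - j) := by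
  calc ∑ q : Plaq (F.P K) j, f q ≤ ∑ _q : Plaq (F.P K) j, B (K - j) := Finset.sum_le_sum fun q _ => hf q
    _ = (Fintype.card (Plaq (F.P K) j) : ℝ) * B (K - j) := by rw [Finset.sum_const, nsmul_eq_mul, Finset.card_univ]
    _ ≤ 72 * (F.L : ℝ) ^ (3 * F.m) * ((F.L : ℝ) ^ (K - j)) ^ 3 * B (K - j) :=
        mul_le_mul_of_nonneg_right (CutoffNotchTransport.card_plaq_le_height F hj) hB

/-- **THE REFLECTED GEOMETRIC SERIES over the constrained levels**: for `W ≥ 0` dominated by the ratio `¼` from `n₀` on, `n ≤ J` and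
`n₀ ≤ h + n`, `Σ_{j < J − n + 1} W(J + h − j) ≤ (4/3)·W(h + n)` (the levels `j ≤ J − n` of run `J + h` sit at the depths `J + h − j ≥ h + n`).
[folklore] -/
theorem sum_range_W_le {W : ℕ → ℝ} {n₀ : ℕ} (hW0 : ∀ k, 0 ≤ W k) (hW : ∀ k, n₀ ≤ k → W (k + 1) ≤ W k / 4)
    {J n h : ℕ} (hn : n ≤ J) (hn₀ : n₀ ≤ h + n) :
    ∑ j ∈ Finset.range (J - n + 1), W (J + h - j) ≤ 4 / 3 * W (h + n) := by
  have hgeom : Summable (fun k : ℕ => ((1 : ℝ) / 4) ^ k) := summable_geometric_of_lt_one (by norm_num) (by norm_num)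
  have htsum : ∑' k : ℕ, ((1 : ℝ) / 4) ^ k = 4 / 3 := by
    rw [tsum_geometric_of_lt_one (by norm_num) (by norm_num)]; norm_num
  have hrefl : ∑ j ∈ Finset.range (J - n + 1), W (J + h - j) = ∑ t ∈ Finset.range (J - n + 1), W (h + n + t) := by
    rw [← Finset.sum_range_reflect (fun t => W (h + n + t)) (J - n + 1)]
    refine Finset.sum_congr rfl fun j hj => ?_
    rw [Finset.mem_range] at hj
    congr 1; omega
  rw [hrefl]
  calc ∑ t ∈ Finset.range (J - n + 1), W (h + n + t) ≤ ∑ t ∈ Finset.range (J - n + 1), ((1 : ℝ) / 4) ^ t * W (h + n) :=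
        Finset.sum_le_sum fun t _ => le_quarter_pow_mul hW hn₀ t
    _ = (∑ t ∈ Finset.range (J - n + 1), ((1 : ℝ) / 4) ^ t) * W (h + n) := by rw [Finset.sum_mul]
    _ ≤ (∑' k : ℕ, ((1 : ℝ) / 4) ^ k) * W (h + n) :=
        mul_le_mul_of_nonneg_right (hgeom.sum_le_tsum _ fun k _ => by positivity) (hW0 _)
    _ = 4 / 3 * W (h + n) := by rw [htsum]

/-- **A DEFECT IS `≤ (7/3)·W(h + n)`**: the double sum over the constrained levels plus the window level, both bounded through `W`.
[folklore] -/
theorem defect_le {W : ℕ → ℝ} {n₀ : ℕ} (hW0 : ∀ k, 0 ≤ W k) (hW : ∀ k, n₀ ≤ k → W (k + 1) ≤ W k / 4)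
    {J n h : ℕ} (hn : n ≤ J) (hn₀ : n₀ ≤ h + n) {S T : ℝ}
    (hS : S ≤ ∑ j ∈ Finset.range (J - n + 1), W (J + h - j)) (hT : T ≤ W (J + h - (J - n))) :
    S + T ≤ 7 / 3 * W (h + n) := by
  have h1 := sum_range_W_le hW0 hW hn hn₀
  rw [show J + h - (J - n) = h + n by omega] at hT
  linarith

/-- From the depth `h + 1` to the depth `h + n` (`n ≥ 1`): `W(h + n) ≤ 4·(¼)^n·W(h + 1)` for a `¼`-dominated `W` (`n₀ ≤ h + 1`). [folklore] -/
theorem W_depth_le {W : ℕ → ℝ} {n₀ : ℕ} (hW : ∀ k, n₀ ≤ k → W (k + 1) ≤ W k / 4)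
    {h n : ℕ} (hn : 1 ≤ n) (hn₀ : n₀ ≤ h + 1) :
    W (h + n) ≤ 4 * ((1 : ℝ) / 4) ^ n * W (h + 1) := by
  obtain ⟨k, rfl⟩ : ∃ k, n = k + 1 := ⟨n - 1, by omega⟩
  have h1 := le_quarter_pow_mul hW hn₀ k
  rw [show h + 1 + k = h + (k + 1) by omega] at h1
  calc W (h + (k + 1)) ≤ ((1 : ℝ) / 4) ^ k * W (h + 1) := h1
    _ = 4 * ((1 : ℝ) / 4) ^ (k + 1) * W (h + 1) := by rw [pow_succ]; ring

end Bookkeeping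

end Summit.QuantumFields.YangMills.Theorems.HistoryTailOfLocalStability

end
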